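import Mathlib
import HarnessLib
import Literature.Computability.AlgebraicComplexity.TensorSemiringSpectrum
import Literature.Computability.AlgebraicComplexity.AsymptoticSpectrumDuality
import Literature.Computability.AlgebraicComplexity.AsymptoticRankMatMul
import Summits.MatrixMultiplication.MatrixMultiplication.Theses.OutsiderSandwich
import Summits.MatrixMultiplication.MatrixMultiplication.Theorems.OutsiderSandwichTopFibre
import Summits.MatrixMultiplication.MatrixMultiplication.Theorems.OutsiderSandwichLaserFloorTop
import Summits.MatrixMultiplication.MatrixMultiplication.Theorems.OutsiderSandwichSlopeDial
import Summits.MatrixMultiplication.MatrixMultiplication.Theorems.OutsiderSandwichBlock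

/-!
# OutsiderSandwich — the top fibre of `T(ℂ)` at `⟨2,2,2⟩`: the minimal criminal exists, and the
residual `LaserMergeOptimal` in CATALYTIC form (decomp-mm lens 4, gen 34, part 2/3)

Route `route-MatrixMultiplication-OutsiderSandwich`; cut of record UNCHANGED
(`closes (h₁ : LaserTangency) (h₂ : LaserMergeOptimal) (h₃ : SummitIffLaserTangency)`); theorem-only
support for the residual `LaserMergeOptimal` (stmt-27897).  Specialises part 1
(`OutsiderSandwichTopFibre`) to the tensor semiring `T(ℂ)` (tree: `TensorClass`,
`TensorClass.isStrassenPreorder`) at `a = [⟨2,2,2⟩]`, where `R̃(a) = 2^ω`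
(`asymptoticRank_matMulTensor`) and the top fibre is the set of universal spectral points with
`τ_F := log₂ F⟨2,2,2⟩ = ω` (dictionary `eval` / `spectralMapOf` of `TensorSemiringSpectrum`).

§1 Dictionary (`asympRankOf_mk_matMul`, `eval_top_iff`, `spectralMapOf_top_iff`,
   `forall_top_iff_abstract`): a statement about the values of TOP universal points on finitely many
   tensors is the same statement about the top fibre of `X(T(ℂ))` at `[⟨2,2,2⟩]`.

§2 **THE MINIMAL CRIMINAL EXISTS** (`exists_top_min`, `exists_top_max`, `exists_top_lexMin`): for
   every tensor `t` some top universal point MINIMISES `F(t)` among all top universal points (and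
   some maximises it, and lexicographic refinements exist).  g32 (`OutsiderSandwichTopSlope`) wrote
   «no compactness of the top fibre is available for `SpectralMap` … attainment is NOT claimed»; it
   is available through `T(ℂ)` (as g13's `OutsiderSandwichTouchingPoints` already used for cluster
   points), and part 3 upgrades every inf-statement of g32 to its attained form.

§3 **Catalytic localisation for tensors** (`topLe_iff_catalytic`, `topLt_iff_catalytic`): for
   tensors `s, t`,
   `(∀ top F, F s ≤ F t) ⟺ ∀ k ∃ l r ∈ ℕ, r ≤ l·2^ω + 2 ∧ k[s] + l[⟨2,2,2⟩] ≲ k[t] + r`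
   in `T(ℂ)` (`≲ = AsympLe (· ≤ ·)`, i.e. sub-exponentially helped restriction of Kronecker powers,
   g19 `OutsiderSandwichBlockOneOperational.asympLe_mk_iff_helped`).  g19 operationalised inequalities
   valid at ALL universal points (`forall_universal_le_iff_asympLe`); the residual and the top slope
   live on the TOP FIBRE only, and this is their operational form: matrix multiplication tensors act as
   a CATALYST refunded at price `2^ω` per copy.

§4 **The laser floor is an asymptotic restriction, and the residual is its tightness at the top**
   (`laserFloor_cube`, `laserFloor_asympLe`, `laserMergeOptimal_iff_top_le`,
   `not_laserMergeOptimal_iff_top_lt`, `not_laserMergeOptimal_iff_catalytic`,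
   `laserMergeOptimal_iff_no_catalytic`):
   * unconditionally `27·[⟨2,2,2⟩] ≲ 4·[cw₂]³` in `T(ℂ)` (Coppersmith–Winograd's floor
     `x_F ≥ log₂3 + (τ_F−2)/3` is `27 F⟨2,2,2⟩ ≤ 4 F(cw₂)³` at every spectral point + Strassen's
     spectral theorem);
   * `LaserMergeOptimal ⟺ ∃ top F, 4 F(cw₂)³ ≤ 27 F⟨2,2,2⟩` (equality at a top point);
   * `¬ LaserMergeOptimal ⟺ ∃ n ∀ k ∃ l r ∈ ℕ, r ≤ l·2^ω + 2 ∧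
        k(27n[⟨2,2,2⟩] + 1) + l[⟨2,2,2⟩] ≲ 4nk[cw₂]³ + r`
     — a counterexample to the residual IS one explicit catalytic asymptotic restriction family
     squeezing an extra diagonal `⟨k⟩`, beyond the `27nk` matrix products the laser method already
     extracts, out of `4nk` copies of `cw₂^{⊠3}` with `⟨2,2,2⟩`-catalysis refunded at `2^ω` a copy;
     and `LaserMergeOptimal` is the non-existence of such refunds (`∀ n ∃ k ∀ l r, …→ ¬ …`).
   Since `LaserMergeOptimal` is NECESSARY for `ω = 2` (g5), exhibiting such a family proves `ω > 2`;
   proving the residual means excluding it for every `n`.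

Honest tags: NEC for nothing new (support only); no finite level is touched (every statement is on the
asymptotic preorder); `ω` enters only as the refund price `R̃(⟨2,2,2⟩) = 2^ω`.
References: [cite: Strassen1988, Thm. 2.3–2.4, Thm. 3.8]; [cite: Zuiddam2018, Thm. 2.12, Thm. 2.15];
[cite: CoppersmithWinograd1990, §6]; [cite: ChristandlVranaZuiddam2023, Prop. 1.6]; Alman–Li–Pratt,
arXiv:2604.01386 (2026) §3 (localised preorders `≼_f`, nearest prior art for §3).
-/

set_option linter.dupNamespace false

noncomputable section

namespace Summit.MatrixMultiplication.MatrixMultiplication.Theorems.OutsiderSandwichTopFibreTensor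

open Literature.Computability.AlgebraicComplexity
open Summit.MatrixMultiplication.MatrixMultiplication.Theses.OutsiderSandwich
open Summit.MatrixMultiplication.MatrixMultiplication.Theorems.OutsiderSandwichLaserFloor
  (one_le_map_matMulTensor two_le_matExp laserFloor laserFloor_mul)
open Summit.MatrixMultiplication.MatrixMultiplication.Theorems.OutsiderSandwichLaserFloorCut
  (three_le_map_cwTensor matExp_le_omega)
open Summit.MatrixMultiplication.MatrixMultiplication.Theorems.OutsiderSandwichLaserFloorTop
  (exists_top_point)
open Summit.MatrixMultiplication.MatrixMultiplication.Theorems.OutsiderSandwichSlopeDialCore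
  (SlopeCap)
open Summit.MatrixMultiplication.MatrixMultiplication.Theorems.OutsiderSandwichSlopeDial
  (cwCap_third_iff)
open Summit.MatrixMultiplication.MatrixMultiplication.Theorems.OutsiderSandwichBlock
  (map_matMulTensor_pos)
open Summit.MatrixMultiplication.MatrixMultiplication.Theorems.OutsiderSandwichTopFibre

variable {F : SpectralMap ℂ}

/-! ## §1  Dictionary: top universal points = the top fibre of `X(T(ℂ))` at `[⟨2,2,2⟩]` -/

/-- `R̃([⟨2,2,2⟩]) = 2^ω` in the tensor semiring. [cite: Strassen1988, Thm. 3.8] -/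
theorem asympRankOf_mk_matMul :
    asympRankOf (fun x y : TensorClass ℂ => x ≤ y) (TensorClass.mk (matMulTensor ℂ 2 2 2)) =
      (2 : ℝ) ^ omega ℂ := by
  rw [TensorClass.asympRankOf_mk, asymptoticRank_matMulTensor ℂ 2 (by norm_num)]
  norm_num

/-- `F⟨2,2,2⟩ = 2^ω ⟺ τ_F = ω`. -/
theorem map_matMul_eq_iff_matExp_eq (hF : IsUniversalSpectralPoint ℂ F) :
    F (matMulTensor ℂ 2 2 2) = (2 : ℝ) ^ omega ℂ ↔
      Real.logb 2 (F (matMulTensor ℂ 2 2 2)) = omega ℂ := by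
  constructor
  · intro h
    rw [h, Real.logb_rpow two_pos (by norm_num)]
  · intro h
    have h0 := map_matMulTensor_pos hF
    rw [← h]
    exact (Real.rpow_logb two_pos (by norm_num) h0).symm

/-- The spectral point `eval F` of `T(ℂ)` is top at `[⟨2,2,2⟩]` iff `F` is a top universal point. -/
theorem eval_top_iff (hF : IsUniversalSpectralPoint ℂ F) :
    TensorClass.eval F (TensorClass.mk (matMulTensor ℂ 2 2 2)) =
      asympRankOf (fun x y : TensorClass ℂ => x ≤ y) (TensorClass.mk (matMulTensor ℂ 2 2 2)) ↔
      Real.logb 2 (F (matMulTensor ℂ 2 2 2)) = omega ℂ := by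
  rw [TensorClass.eval_mk hF, asympRankOf_mk_matMul, map_matMul_eq_iff_matExp_eq hF]

/-- The universal point `spectralMapOf φ` is top iff `φ` lies in the top fibre at `[⟨2,2,2⟩]`. -/
theorem spectralMapOf_top_iff {φ : TensorClass ℂ → ℝ}
    (hφ : IsSpectralPoint (fun x y : TensorClass ℂ => x ≤ y) φ) :
    Real.logb 2 (TensorClass.spectralMapOf φ (matMulTensor ℂ 2 2 2)) = omega ℂ ↔
      φ (TensorClass.mk (matMulTensor ℂ 2 2 2)) =
        asympRankOf (fun x y : TensorClass ℂ => x ≤ y) (TensorClass.mk (matMulTensor ℂ 2 2 2)) := by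
  rw [← map_matMul_eq_iff_matExp_eq (TensorClass.isUniversalSpectralPoint_spectralMapOf hφ),
    TensorClass.spectralMapOf_apply, asympRankOf_mk_matMul]

/-- The top fibre of `X(T(ℂ))` at `[⟨2,2,2⟩]` is nonempty. [cite: Strassen1988, Thm. 3.8] -/
theorem topFibre_nonempty :
    ∃ φ : TensorClass ℂ → ℝ, IsSpectralPoint (fun x y : TensorClass ℂ => x ≤ y) φ ∧
      φ (TensorClass.mk (matMulTensor ℂ 2 2 2)) =
        asympRankOf (fun x y : TensorClass ℂ => x ≤ y) (TensorClass.mk (matMulTensor ℂ 2 2 2)) := by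
  obtain ⟨G, hG, hGω⟩ := exists_top_point
  exact ⟨TensorClass.eval G, TensorClass.isSpectralPoint_eval hG, (eval_top_iff hG).2 hGω⟩

/-- **Bridge.**  A relation between the values of TOP universal points at two tensors `s, t` holds
iff it holds on the top fibre of `X(T(ℂ))` at `[⟨2,2,2⟩]`. [cite: ChristandlVranaZuiddam2023, §1.2] -/
theorem forall_top_iff_abstract {ι κ μ ι' κ' μ' : Type} [Fintype ι] [Fintype κ] [Fintype μ]
    [Fintype ι'] [Fintype κ'] [Fintype μ'] (s : ι → κ → μ → ℂ) (t : ι' → κ' → μ' → ℂ)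
    (R : ℝ → ℝ → Prop) :
    (∀ F : SpectralMap ℂ, IsUniversalSpectralPoint ℂ F →
        Real.logb 2 (F (matMulTensor ℂ 2 2 2)) = omega ℂ → R (F s) (F t)) ↔
    (∀ φ : TensorClass ℂ → ℝ, IsSpectralPoint (fun x y : TensorClass ℂ => x ≤ y) φ →
        φ (TensorClass.mk (matMulTensor ℂ 2 2 2)) =
          asympRankOf (fun x y : TensorClass ℂ => x ≤ y) (TensorClass.mk (matMulTensor ℂ 2 2 2)) →
        R (φ (TensorClass.mk s)) (φ (TensorClass.mk t))) := by
  constructor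
  · intro H φ hφ hφa
    have hU := TensorClass.isUniversalSpectralPoint_spectralMapOf hφ
    have h1 := H _ hU ((spectralMapOf_top_iff hφ).2 hφa)
    rwa [TensorClass.spectralMapOf_apply, TensorClass.spectralMapOf_apply] at h1
  · intro H F hF hFω
    have h1 := H _ (TensorClass.isSpectralPoint_eval hF) ((eval_top_iff hF).2 hFω)
    rwa [TensorClass.eval_mk hF, TensorClass.eval_mk hF] at h1

/-! ## §2  The minimal criminal exists: extremal top universal points -/

section Extremal

variable {ι κ μ ι' κ' μ' : Type} [Fintype ι] [Fintype κ] [Fintype μ]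
  [Fintype ι'] [Fintype κ'] [Fintype μ']

/-- **Minimum over the top fibre is attained**: for every tensor `t` there is a top universal point
`F` (`τ_F = ω`) with `F(t) ≤ G(t)` for every top universal point `G`.
[cite: Zuiddam2018, Thm. 2.15; Strassen1988, Thm. 2.3] -/
theorem exists_top_min (t : ι → κ → μ → ℂ) :
    ∃ F : SpectralMap ℂ, IsUniversalSpectralPoint ℂ F ∧
      Real.logb 2 (F (matMulTensor ℂ 2 2 2)) = omega ℂ ∧
      ∀ G : SpectralMap ℂ, IsUniversalSpectralPoint ℂ G →
        Real.logb 2 (G (matMulTensor ℂ 2 2 2)) = omega ℂ → F t ≤ G t := by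
  obtain ⟨φ, hφ, hφa, hmin⟩ :=
    exists_top_isMinOn (TensorClass.isStrassenPreorder ℂ) topFibre_nonempty (TensorClass.mk t)
  refine ⟨TensorClass.spectralMapOf φ, TensorClass.isUniversalSpectralPoint_spectralMapOf hφ,
    (spectralMapOf_top_iff hφ).2 hφa, fun G hG hGω => ?_⟩
  rw [TensorClass.spectralMapOf_apply, ← TensorClass.eval_mk hG t]
  exact hmin _ (TensorClass.isSpectralPoint_eval hG) ((eval_top_iff hG).2 hGω)

/-- **Maximum over the top fibre is attained.** [cite: Zuiddam2018, Thm. 2.15] -/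
theorem exists_top_max (t : ι → κ → μ → ℂ) :
    ∃ F : SpectralMap ℂ, IsUniversalSpectralPoint ℂ F ∧
      Real.logb 2 (F (matMulTensor ℂ 2 2 2)) = omega ℂ ∧
      ∀ G : SpectralMap ℂ, IsUniversalSpectralPoint ℂ G →
        Real.logb 2 (G (matMulTensor ℂ 2 2 2)) = omega ℂ → G t ≤ F t := by
  obtain ⟨φ, hφ, hφa, hmax⟩ :=
    exists_top_isMaxOn (TensorClass.isStrassenPreorder ℂ) topFibre_nonempty (TensorClass.mk t)
  refine ⟨TensorClass.spectralMapOf φ, TensorClass.isUniversalSpectralPoint_spectralMapOf hφ,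
    (spectralMapOf_top_iff hφ).2 hφa, fun G hG hGω => ?_⟩
  rw [TensorClass.spectralMapOf_apply, ← TensorClass.eval_mk hG t]
  exact hmax _ (TensorClass.isSpectralPoint_eval hG) ((eval_top_iff hG).2 hGω)

/-- **Lexicographically minimal top point** (the lens's normal form of a counterexample): a top
universal point minimising `F(t)` among top points and, among those, minimising `F(u)`.
[cite: Zuiddam2018, Thm. 2.15] -/
theorem exists_top_lexMin (t : ι → κ → μ → ℂ) (u : ι' → κ' → μ' → ℂ) :
    ∃ F : SpectralMap ℂ, IsUniversalSpectralPoint ℂ F ∧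
      Real.logb 2 (F (matMulTensor ℂ 2 2 2)) = omega ℂ ∧
      (∀ G : SpectralMap ℂ, IsUniversalSpectralPoint ℂ G →
        Real.logb 2 (G (matMulTensor ℂ 2 2 2)) = omega ℂ → F t ≤ G t) ∧
      (∀ G : SpectralMap ℂ, IsUniversalSpectralPoint ℂ G →
        Real.logb 2 (G (matMulTensor ℂ 2 2 2)) = omega ℂ → G t = F t → F u ≤ G u) := by
  obtain ⟨φ, hφ, hφa, hmin, hmin'⟩ :=
    exists_top_isMinOn_isMinOn (TensorClass.isStrassenPreorder ℂ) topFibre_nonempty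
      (TensorClass.mk t) (TensorClass.mk u)
  refine ⟨TensorClass.spectralMapOf φ, TensorClass.isUniversalSpectralPoint_spectralMapOf hφ,
    (spectralMapOf_top_iff hφ).2 hφa, fun G hG hGω => ?_, fun G hG hGω hGt => ?_⟩
  · rw [TensorClass.spectralMapOf_apply, ← TensorClass.eval_mk hG t]
    exact hmin _ (TensorClass.isSpectralPoint_eval hG) ((eval_top_iff hG).2 hGω)
  · rw [TensorClass.spectralMapOf_apply, ← TensorClass.eval_mk hG u]
    rw [TensorClass.spectralMapOf_apply, ← TensorClass.eval_mk hG t] at hGt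
    exact hmin' _ (TensorClass.isSpectralPoint_eval hG) ((eval_top_iff hG).2 hGω) hGt

/-! ## §3  Catalytic localisation for tensors: top-fibre inequalities as asymptotic restrictions -/

/-- **`(∀ top F, F s ≤ F t) ⟺ ∀ k ∃ l r ∈ ℕ, r ≤ l·2^ω + 2 ∧ k[s] + l[⟨2,2,2⟩] ≲ k[t] + r`**
in the tensor semiring `T(ℂ)`. [cite: Zuiddam2018, Thm. 2.12, Thm. 2.15; Strassen1988, Thm. 3.8] -/
theorem topLe_iff_catalytic (s : ι → κ → μ → ℂ) (t : ι' → κ' → μ' → ℂ) :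
    (∀ F : SpectralMap ℂ, IsUniversalSpectralPoint ℂ F →
        Real.logb 2 (F (matMulTensor ℂ 2 2 2)) = omega ℂ → F s ≤ F t) ↔
    ∀ k : ℕ, ∃ l r : ℕ, (r : ℝ) ≤ l * (2 : ℝ) ^ omega ℂ + 2 ∧
      AsympLe (fun x y : TensorClass ℂ => x ≤ y)
        ((k : TensorClass ℂ) * TensorClass.mk s + (l : TensorClass ℂ) * TensorClass.mk (matMulTensor ℂ 2 2 2))
        ((k : TensorClass ℂ) * TensorClass.mk t + (r : TensorClass ℂ)) := by
  have hb := forall_top_iff_abstract s t (fun u v => u ≤ v)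
  rw [hb, OutsiderSandwichTopFibre.topLe_iff_catalytic (TensorClass.isStrassenPreorder ℂ),
    asympRankOf_mk_matMul]

/-- **Strict version**: `(∀ top F, F s < F t) ⟺ ∃ n ∀ k ∃ l r ∈ ℕ, r ≤ l·2^ω + 2 ∧
k(n[s] + 1) + l[⟨2,2,2⟩] ≲ k(n[t]) + r`. [cite: Zuiddam2018, Thm. 2.12, Thm. 2.15] -/
theorem topLt_iff_catalytic (s : ι → κ → μ → ℂ) (t : ι' → κ' → μ' → ℂ) :
    (∀ F : SpectralMap ℂ, IsUniversalSpectralPoint ℂ F →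
        Real.logb 2 (F (matMulTensor ℂ 2 2 2)) = omega ℂ → F s < F t) ↔
    ∃ n : ℕ, ∀ k : ℕ, ∃ l r : ℕ, (r : ℝ) ≤ l * (2 : ℝ) ^ omega ℂ + 2 ∧
      AsympLe (fun x y : TensorClass ℂ => x ≤ y)
        ((k : TensorClass ℂ) * ((n : TensorClass ℂ) * TensorClass.mk s + 1) +
          (l : TensorClass ℂ) * TensorClass.mk (matMulTensor ℂ 2 2 2))
        ((k : TensorClass ℂ) * ((n : TensorClass ℂ) * TensorClass.mk t) + (r : TensorClass ℂ)) := by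
  have hb := forall_top_iff_abstract s t (fun u v => u < v)
  rw [hb, OutsiderSandwichTopFibre.topLt_iff_catalytic (TensorClass.isStrassenPreorder ℂ),
    asympRankOf_mk_matMul]

end Extremal

/-! ## §4  The laser floor as an asymptotic restriction; the residual as its tightness at the top -/

/-- **Laser floor, cubed**: `27 · F⟨2,2,2⟩ ≤ 4 · F(cw₂)³` for every universal spectral point
(`x_F ≥ log₂3 + (τ_F − 2)/3` exponentiated). [cite: CoppersmithWinograd1990, §6] -/
theorem laserFloor_cube (hF : IsUniversalSpectralPoint ℂ F) :
    27 * F (matMulTensor ℂ 2 2 2) ≤ 4 * F (cwTensor ℂ 2) ^ 3 := by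
  have h := laserFloor_mul hF
  have hM0 : 0 < F (matMulTensor ℂ 2 2 2) := map_matMulTensor_pos hF
  set τ := Real.logb 2 (F (matMulTensor ℂ 2 2 2)) with hτ
  have h3 : (3 * (2 : ℝ) ^ ((τ - 2) / 3)) ^ 3 ≤ F (cwTensor ℂ 2) ^ 3 :=
    pow_le_pow_left₀ (by positivity) h 3
  have e1 : ((2 : ℝ) ^ ((τ - 2) / 3)) ^ 3 = (2 : ℝ) ^ (τ - 2) := by
    rw [← Real.rpow_natCast ((2 : ℝ) ^ ((τ - 2) / 3)) 3, ← Real.rpow_mul (by norm_num : (0 : ℝ) ≤ 2)]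
    congr 1
    push_cast
    ring
  have e2 : (2 : ℝ) ^ (τ - 2) = F (matMulTensor ℂ 2 2 2) / 4 := by
    rw [Real.rpow_sub two_pos, Real.rpow_logb two_pos (by norm_num) hM0]
    norm_num
  have e3 : (3 * (2 : ℝ) ^ ((τ - 2) / 3)) ^ 3 = 27 * F (matMulTensor ℂ 2 2 2) / 4 := by
    rw [mul_pow, e1, e2]; ring
  rw [e3] at h3
  linarith

/-- **The laser floor is an asymptotic restriction in `T(ℂ)`**: `27·[⟨2,2,2⟩] ≲ 4·[cw₂]³`
(sub-exponentially helped restriction of Kronecker powers of `4 ⊙ cw₂^{⊠3}` onto those of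
`27 ⊙ ⟨2,2,2⟩`). [cite: CoppersmithWinograd1990, §6; Zuiddam2018, Thm. 2.12] -/
theorem laserFloor_asympLe :
    AsympLe (fun x y : TensorClass ℂ => x ≤ y)
      (((27 : ℕ) : TensorClass ℂ) * TensorClass.mk (matMulTensor ℂ 2 2 2))
      (((4 : ℕ) : TensorClass ℂ) * TensorClass.mk (cwTensor ℂ 2) ^ 3) := by
  refine (TensorClass.isStrassenPreorder ℂ).asympLe_of_forall_spectralPoint _ _ fun φ hφ => ?_
  rw [hφ.map_mul, hφ.map_mul, hφ.map_natCast, hφ.map_natCast, hφ.map_pow]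
  have hU := TensorClass.isUniversalSpectralPoint_spectralMapOf hφ
  have h1 := laserFloor_cube hU
  rw [TensorClass.spectralMapOf_apply, TensorClass.spectralMapOf_apply] at h1
  exact_mod_cast h1

/-- For a universal point: `x_F ≤ log₂3 + (τ_F − 2)/3 ⟺ 4 F(cw₂)³ ≤ 27 F⟨2,2,2⟩`. -/
theorem xExp_le_floor_iff (hF : IsUniversalSpectralPoint ℂ F) :
    Real.logb 2 (F (cwTensor ℂ 2)) ≤
        Real.logb 2 3 + (Real.logb 2 (F (matMulTensor ℂ 2 2 2)) - 2) / 3 ↔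
      4 * F (cwTensor ℂ 2) ^ 3 ≤ 27 * F (matMulTensor ℂ 2 2 2) := by
  have hM0 : 0 < F (matMulTensor ℂ 2 2 2) := map_matMulTensor_pos hF
  have hC0 : 0 < F (cwTensor ℂ 2) := lt_of_lt_of_le (by norm_num) (three_le_map_cwTensor hF)
  have key : 4 * F (cwTensor ℂ 2) ^ 3 ≤ 27 * F (matMulTensor ℂ 2 2 2) ↔
      Real.logb 2 (4 * F (cwTensor ℂ 2) ^ 3) ≤ Real.logb 2 (27 * F (matMulTensor ℂ 2 2 2)) :=
    (Real.logb_le_logb one_lt_two (by positivity) (by positivity)).symm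
  have h4 : Real.logb 2 (4 : ℝ) = 2 := by
    rw [show (4 : ℝ) = 2 ^ (2 : ℕ) by norm_num, Real.logb_pow, Real.logb_self_eq_one one_lt_two]
    norm_num
  have h27 : Real.logb 2 (27 : ℝ) = 3 * Real.logb 2 3 := by
    rw [show (27 : ℝ) = 3 ^ (3 : ℕ) by norm_num, Real.logb_pow]
    norm_num
  have e1 : Real.logb 2 (4 * F (cwTensor ℂ 2) ^ 3) = 2 + 3 * Real.logb 2 (F (cwTensor ℂ 2)) := by
    rw [Real.logb_mul (by norm_num) (by positivity), Real.logb_pow, h4]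
    push_cast
    ring
  have e2 : Real.logb 2 (27 * F (matMulTensor ℂ 2 2 2)) =
      3 * Real.logb 2 3 + Real.logb 2 (F (matMulTensor ℂ 2 2 2)) := by
    rw [Real.logb_mul (by norm_num) hM0.ne', h27]
  rw [key, e1, e2]
  constructor <;> intro h <;> linarith

/-- **The residual is equality in the laser floor at a top point**:
`LaserMergeOptimal ⟺ ∃ F universal, τ_F = ω ∧ 4 F(cw₂)³ ≤ 27 F⟨2,2,2⟩` (then `=`, by
`laserFloor_cube`). [cite: CoppersmithWinograd1990, §6; Strassen1988, Thm. 2.3–2.4] -/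
theorem laserMergeOptimal_iff_top_le :
    LaserMergeOptimal ↔ ∃ F : SpectralMap ℂ, IsUniversalSpectralPoint ℂ F ∧
      Real.logb 2 (F (matMulTensor ℂ 2 2 2)) = omega ℂ ∧
      4 * F (cwTensor ℂ 2) ^ 3 ≤ 27 * F (matMulTensor ℂ 2 2 2) := by
  rw [← cwCap_third_iff]
  unfold SlopeCap
  refine exists_congr fun G => and_congr_right fun hG => and_congr_right fun hGω => ?_
  rw [← xExp_le_floor_iff hG, hGω]
  constructor <;> intro h <;> linarith

/-- **`¬ LaserMergeOptimal ⟺` the laser floor is STRICT at every top point**: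
`∀ F universal, τ_F = ω → 27 F⟨2,2,2⟩ < 4 F(cw₂)³`. [cite: CoppersmithWinograd1990, §6] -/
theorem not_laserMergeOptimal_iff_top_lt :
    ¬ LaserMergeOptimal ↔ ∀ F : SpectralMap ℂ, IsUniversalSpectralPoint ℂ F →
      Real.logb 2 (F (matMulTensor ℂ 2 2 2)) = omega ℂ →
      27 * F (matMulTensor ℂ 2 2 2) < 4 * F (cwTensor ℂ 2) ^ 3 := by
  rw [laserMergeOptimal_iff_top_le]
  push Not
  rfl

/-- **THE RESIDUAL'S COUNTEREXAMPLE IN CATALYTIC FORM.**  With `a = [⟨2,2,2⟩]`, `c = [cw₂]` in `T(ℂ)`: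
`¬ LaserMergeOptimal ⟺ ∃ n ∀ k ∃ l r ∈ ℕ, r ≤ l·2^ω + 2 ∧ k·(n·(27a) + 1) + l·a ≲ k·(n·(4c³)) + r`.
[cite: Zuiddam2018, Thm. 2.12, Thm. 2.15; CoppersmithWinograd1990, §6; Strassen1988, Thm. 3.8] -/
theorem not_laserMergeOptimal_iff_catalytic :
    ¬ LaserMergeOptimal ↔ ∃ n : ℕ, ∀ k : ℕ, ∃ l r : ℕ, (r : ℝ) ≤ l * (2 : ℝ) ^ omega ℂ + 2 ∧
      AsympLe (fun x y : TensorClass ℂ => x ≤ y)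
        ((k : TensorClass ℂ) * ((n : TensorClass ℂ) *
            (((27 : ℕ) : TensorClass ℂ) * TensorClass.mk (matMulTensor ℂ 2 2 2)) + 1) +
          (l : TensorClass ℂ) * TensorClass.mk (matMulTensor ℂ 2 2 2))
        ((k : TensorClass ℂ) * ((n : TensorClass ℂ) *
            (((4 : ℕ) : TensorClass ℂ) * TensorClass.mk (cwTensor ℂ 2) ^ 3)) + (r : TensorClass ℂ)) := by
  rw [not_laserMergeOptimal_iff_top_lt]
  have hb := forall_top_iff_abstract (cwTensor ℂ 2) (matMulTensor ℂ 2 2 2)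
    (fun u v => 27 * v < 4 * u ^ 3)
  rw [hb, asympRankOf_mk_matMul]
  have hS := TensorClass.isStrassenPreorder ℂ
  have key := OutsiderSandwichTopFibre.topLt_iff_catalytic hS
    (TensorClass.mk (matMulTensor ℂ 2 2 2))
    (((27 : ℕ) : TensorClass ℂ) * TensorClass.mk (matMulTensor ℂ 2 2 2))
    (((4 : ℕ) : TensorClass ℂ) * TensorClass.mk (cwTensor ℂ 2) ^ 3)
  rw [asympRankOf_mk_matMul] at key
  rw [← key]
  refine forall_congr' fun φ => forall_congr' fun hφ => forall_congr' fun _ => ?_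
  rw [hφ.map_mul, hφ.map_mul, hφ.map_natCast, hφ.map_natCast, hφ.map_pow]
  push_cast
  exact Iff.rfl

/-- **The residual as NON-EXISTENCE of catalytic refunds**:
`LaserMergeOptimal ⟺ ∀ n ∃ k ∀ l r ∈ ℕ, r ≤ l·2^ω + 2 → ¬ (k·(n·(27a) + 1) + l·a ≲ k·(n·(4c³)) + r)`.
[cite: Zuiddam2018, Thm. 2.12, Thm. 2.15; CoppersmithWinograd1990, §6] -/
theorem laserMergeOptimal_iff_no_catalytic :
    LaserMergeOptimal ↔ ∀ n : ℕ, ∃ k : ℕ, ∀ l r : ℕ, (r : ℝ) ≤ l * (2 : ℝ) ^ omega ℂ + 2 →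
      ¬ AsympLe (fun x y : TensorClass ℂ => x ≤ y)
        ((k : TensorClass ℂ) * ((n : TensorClass ℂ) *
            (((27 : ℕ) : TensorClass ℂ) * TensorClass.mk (matMulTensor ℂ 2 2 2)) + 1) +
          (l : TensorClass ℂ) * TensorClass.mk (matMulTensor ℂ 2 2 2))
        ((k : TensorClass ℂ) * ((n : TensorClass ℂ) *
            (((4 : ℕ) : TensorClass ℂ) * TensorClass.mk (cwTensor ℂ 2) ^ 3)) + (r : TensorClass ℂ)) := by
  have h := not_laserMergeOptimal_iff_catalytic
  rw [not_iff_comm, Iff.comm] at h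
  rw [h]
  push Not
  exact Iff.rfl

/-- **Summit reading.**  `ω = 2 ⟹` no catalytic refund family exists (the residual is necessary,
g5 `laserMergeOptimal_of_summit`); equivalently, ONE such family certifies `ω > 2`.
[cite: CoppersmithWinograd1990, §6] -/
theorem two_lt_omega_of_catalytic
    (h : ∃ n : ℕ, ∀ k : ℕ, ∃ l r : ℕ, (r : ℝ) ≤ l * (2 : ℝ) ^ omega ℂ + 2 ∧
      AsympLe (fun x y : TensorClass ℂ => x ≤ y)
        ((k : TensorClass ℂ) * ((n : TensorClass ℂ) *
            (((27 : ℕ) : TensorClass ℂ) * TensorClass.mk (matMulTensor ℂ 2 2 2)) + 1) +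
          (l : TensorClass ℂ) * TensorClass.mk (matMulTensor ℂ 2 2 2))
        ((k : TensorClass ℂ) * ((n : TensorClass ℂ) *
            (((4 : ℕ) : TensorClass ℂ) * TensorClass.mk (cwTensor ℂ 2) ^ 3)) + (r : TensorClass ℂ))) :
    2 < omega ℂ := by
  have hne : ¬ LaserMergeOptimal := not_laserMergeOptimal_iff_catalytic.2 h
  rcases (OutsiderSandwichSlopeDialCore.two_le_omega).eq_or_lt with h2 | h2
  · exact absurd (OutsiderSandwichLaserTangency.laserMergeOptimal_of_summit
      ((_root_.MatrixMultiplication_iff).2 h2.symm)) hne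
  · exact h2

end Summit.MatrixMultiplication.MatrixMultiplication.Theorems.OutsiderSandwichTopFibreTensor

end
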